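import Summits.BirchSwinnertonDyer.BirchSwinnertonDyer.Theorems.KimAtThreeDeepUpperExpStarFactsCanonical
import HarnessLib

/-!
# The OUTER rescaling lemma with R-κ bookkeeping: «Kato-only datum + 3-adic POSITION ⟹ duality-normalised datum with
# unit constant» — shape-independent in the inner Kato block
# (cell `bsd-addord`, seat w2-acc4 gen 6; crux `KatoKuriharaPortThreeShared` = stmt-BirchSwinnertonDyer-19560;
# `--supports 19560`, helper)

HONEST FRAMING.  TOOL theorems (no definition, no named fact, no instance, no `sorry`); the three cite facts
(P123) `cupLogInjective_and_hasDualExp_of_isDeRham`, (DR) `isDeRham_restrictedRationalTateRep`, (S5b)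
`exists_smul_range_expStarCoord_iff_trace_log` of `Literature/…/PAdicHodge/DualExpElliptic` are HYPOTHESES; nothing
is closed or booked; BSD / 19560 are not proved by this file.

WHAT.  The displayed Kato hypothesis of crux 19560 (kim3's hKatoV2₀, `KimAtThreeFineKatoPerFactorPartsSingle`
l.104–187; consumed BY NAME in `KimAtThreeFineKatoCruxOfFacts`) couples THREE things about ONE generator `d` of the
Néron line `D⁰_dR(V₃W|ℚ_{v₀})`: `hdual(d)` ([BK90]/Tate duality: the range of `exp*_d` is the dual lattice of
`log_ω E(ℚ₃)`), R-κ (`κ ∈ ℚ`, `v₃(κ) = 0` for the constant of Kato's value law read in the `d`-coordinate) and the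
inner Kato block (Kato 2004 over the DEFINED `exp*_d`).  w2-c2 gen 9's rescaling trick
(`KimAtThreeDeepLowerKatoPartsRescale`) removes `hdual` when R-κ is absent (deep family); it cannot keep R-κ,
because the rescaling multiplies `κ` by `3⁻ⁿ`.  THIS FILE proves the outer step ONCE, for an ARBITRARY inner block
`Inner d κ` that is covariant under the rescaling `(d, κ) ↦ (c • d, q·κ)` with `ι c = q⁻¹` (`c ∈ ℚ_vˣ`, `q ∈ ℚˣ`):

  `exists_dual_unit_of_position` — from (P123), (DR), (S5b) and
  «∃ d κ, κ ≠ 0 ∧ POS(d, κ) ∧ Inner d κ», where the **position clause**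
  `POS(d, κ) := ∃ u : ℚ, u = κ ∧ ∀ hinj hex e ≠ 0, hdual(e • d) → v_p(u) = v(ι e)`
  says only «IF `e` rescales `d` to a duality-normalised generator THEN `v_p(κ) = v(e)`» (duality enters as a
  HYPOTHESIS of the clause, never asserted), one gets kim3's outer shape
  «∃ d hinj hex, hdual(d) ∧ ∃ κ, κ ≠ 0 ∧ (∃ u : ℚ, u = κ ∧ v_p(u) = 0) ∧ Inner d κ».

So the typed residual of 19560 may be «Kato-only ∧ POS» (Kato 2004 (8.1.3)/8.12/9.7/6.6(1)/13.3 over the defined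
`exp*` of SOME generator — Kato's own `S(f)`-class — plus the relative 3-adic position of that generator and the
Néron/duality line, which is where the Manin constant / `3 ∤ c_P` live), with the [BK90]/Tate-duality EXISTENCE
content carried by the separately cited (S5b); the deep family's R-κ-free version is w2-c2's theorem.  Also:
`exists_dual_of_inner` (the R-κ-free twin in the same abstract form) and the unit-invariance lemma
`hdual_smul_of_norm_eq_one`.  PROOF = w2-c2's unit/power split `ι e = pⁿ · w`, `‖w‖ = 1`
(`Padic.norm_eq_zpow_neg_valuation`), `d := pⁿ • d_K`, `κ := p⁻ⁿ κ_K`, the unit absorbed by `hdual`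
(`{a : ‖a · log_ω Q‖ ≤ 1}` is `ℤ_pˣ`-stable), and `v_p(p⁻ⁿ u) = v_p(u) − n = 0` by POS.

References: K. Kato, Astérisque 295 (2004) (8.1.3), Prop. 8.12, §9.4, Thm. 9.7, Thm. 6.6 (1), Ex. 13.3 [Kato2004Asterisque];
K. Kato, LNM 1553 (1993) II §1.2.4, Ex. 1.3.5, Thm. 1.4.1 [Kato1993LNM1553]; S. Bloch, K. Kato (1990) §3 Prop. 3.8,
Ex. 3.11 [BlochKato1990]; J.-P. Serre, *Local Fields* (1979) II §5 [SerreLocalFields1979].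
-/

set_option autoImplicit false
-- the Theorems namespace of a single-conjunct summit repeats the summit name by design (D-0017)
set_option linter.dupNamespace false

noncomputable section

open scoped NumberField NNReal
open Field ValuativeRel IsDedekindDomain NumberField
open Literature.NumberTheory.GaloisRepresentations
open Literature.NumberTheory.GaloisRepresentations.PeriodRingData
open Literature.NumberTheory.PAdicHodge
open Literature.NumberTheory.EllipticCurves WeierstrassCurve
open Summit.BirchSwinnertonDyer.BirchSwinnertonDyer.Theorems.KimAtThreeDeepLowerExpStarOmega
open Summit.BirchSwinnertonDyer.BirchSwinnertonDyer.Theorems.KimAtThreeDeepLowerExpStarOmegaPlace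
open Summit.BirchSwinnertonDyer.BirchSwinnertonDyer.Theorems.KimAtThreeDeepUpperExpStarFacts
open Summit.BirchSwinnertonDyer.BirchSwinnertonDyer.Theorems.KimAtThreeDeepUpperExpStarFactsCanonical
open Summit.BirchSwinnertonDyer.Rank1Residual.GaloisImage
open Summit.BirchSwinnertonDyer.Rank1Residual.Additive (LocalLog.padicLog)
open Rat.HeightOneSpectrum

namespace Summit.BirchSwinnertonDyer.BirchSwinnertonDyer.Theorems.KimAtThreeFineKatoOuterRescale

variable (W : WeierstrassCurve ℚ) [W.IsElliptic] (p : ℕ) [Fact p.Prime]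
  (v : HeightOneSpectrum (𝓞 ℚ)) [hv : Fact (((p : ℕ) : 𝓞 ℚ) ∈ v.asIdeal)]

-- the tree's `ℚ`-algebra structure on `ℚ_v` first (see `KimAtThreeDeepUpperExpStarFacts`)
attribute [local instance 100000] NumberField.Place.instAlgebraCompletion
attribute [local instance] valuativeRelPlace topologicalSpacePlace
attribute [local instance] isNonarchimedeanLocalField_place charZero_place
attribute [local instance] padicAlgebraPlace fact_not_isUnit_place isAdicComplete_place

omit hv in
/-- **`hdual` is invariant under rescaling the Néron generator by a `p`-adic UNIT**: if `exp*_{d'} = w · exp*_{d}`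
in `ℚ_p` with `‖w‖ = 1`, then `hdual(d) → hdual(d')` (the dual lattice `{a : ∀ Q, ‖a · log_ω Q‖ ≤ 1}` is
`ℤ_pˣ`-stable).  Pure bookkeeping behind the rescaling trick. [cite: Kato1993LNM1553, Ch. II §1.2.4 and Thm. 1.4.1] -/
theorem hdual_transfer_of_norm_eq_one [W.IsGloballyMinimal]
    {φ φ' : (tateLocalRep W p (Sum.inr v)).cohomology 1 →+ ℚ_[p]} {w : ℚ_[p]} (hw1 : ‖w‖ = 1)
    (hφ : ∀ y, φ' y = w * φ y)
    (hdual : ∀ a : ℚ_[p], (∃ y, φ y = a) ↔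
      ∀ Q : (W.baseChange ℚ_[p]).toAffine.Point, ‖a * LocalLog.padicLog (W.baseChange ℚ_[p]) Q‖ ≤ 1) :
    ∀ a : ℚ_[p], (∃ y, φ' y = a) ↔
      ∀ Q : (W.baseChange ℚ_[p]).toAffine.Point, ‖a * LocalLog.padicLog (W.baseChange ℚ_[p]) Q‖ ≤ 1 := by
  have hw0 : w ≠ 0 := norm_pos_iff.mp (by rw [hw1]; exact one_pos)
  intro a
  constructor
  · rintro ⟨y, hy⟩ Q
    have hy' : φ y = w⁻¹ * a := by rw [← hy, hφ, inv_mul_cancel_left₀ hw0]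
    have hQ := ((hdual (w⁻¹ * a)).mp ⟨y, hy'⟩) Q
    rwa [mul_assoc, norm_mul, norm_inv, hw1, inv_one, one_mul] at hQ
  · intro ha
    obtain ⟨y, hy⟩ := (hdual (w⁻¹ * a)).mpr fun Q => by
      rw [mul_assoc, norm_mul, norm_inv, hw1, inv_one, one_mul]; exact ha Q
    exact ⟨y, by rw [hφ, hy, mul_inv_cancel_left₀ hw0]⟩

/-- **The OUTER rescaling lemma with R-κ bookkeeping.**  For ANY inner block `Inner d κ` covariant under
`(d, κ) ↦ (c • d, q·κ)` whenever `ι c = q⁻¹` (`c ∈ ℚ_vˣ`, `q ∈ ℚˣ`): (P123) ∧ (DR) ∧ (S5b) and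
«∃ d κ, κ ≠ 0 ∧ POS(d, κ) ∧ Inner d κ» give «∃ d hinj hex, hdual(d) ∧ ∃ κ, κ ≠ 0 ∧ (κ ∈ ℚ, v_p(κ) = 0) ∧ Inner d κ»,
where `POS(d, κ) := ∃ u : ℚ, u = κ ∧ ∀ hinj hex (e ≠ 0), hdual(e • d) → v_p(u) = v(ι e)` (duality as a HYPOTHESIS
of the clause).  Proof: (S5b) rescales `d` to a duality-normalised `e • d`; split `ι e = pⁿ · w`, `‖w‖ = 1`; take
`pⁿ • d` (duality-normalised: the unit is absorbed) and `p⁻ⁿ κ` (a `p`-adic unit by POS).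
[cite: Kato1993LNM1553, Ch. II §1.2.4, Ex. 1.3.5 and Thm. 1.4.1] [cite: BlochKato1990, §3 (Prop. 3.8, Ex. 3.11)]
[cite: Kato2004Asterisque, Thm. 9.7 (p. 189) and Thm. 6.6 (1) (p. 163)] -/
theorem exists_dual_unit_of_position [W.IsGloballyMinimal]
    (hP : cupLogInjective_and_hasDualExp_of_isDeRham) (hDR : isDeRham_restrictedRationalTateRep)
    (hT : exists_smul_range_expStarCoord_iff_trace_log)
    (ι : Place.Completion (Sum.inr v : Place ℚ) →+* ℚ_[p])
    (Inner : LocalNeronLineAt W p v → ℝ → Prop)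
    (hcov : ∀ (d : LocalNeronLineAt W p v) (κ : ℝ) (c : Place.Completion (Sum.inr v : Place ℚ)) (hc : c ≠ 0)
      (q : ℚ), q ≠ 0 → ι c = ((q : ℚ_[p]))⁻¹ → Inner d κ → Inner (d.smul c hc) ((q : ℝ) * κ))
    (h : ∃ (d : LocalNeronLineAt W p v) (κ : ℝ), κ ≠ 0 ∧
      (∃ u : ℚ, (u : ℝ) = κ ∧
        ∀ (hinj : (bdRPeriodRingData (valuation_place_lt_one p v)).CupLogInjective (logCyclotomic p)
            (localRationalTateRep W p (galRestrictPlace v)))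
          (hex : ∀ z : contOneCocycles (localRationalTateRep W p (galRestrictPlace v)).toTopRep,
            (bdRPeriodRingData (valuation_place_lt_one p v)).HasDualExp (logCyclotomic p)
              (localRationalTateRep W p (galRestrictPlace v)) fun σ => z.1 σ)
          (e : Place.Completion (Sum.inr v : Place ℚ)) (he : e ≠ 0),
          (∀ a : ℚ_[p], (∃ y, expStarOmegaPadicAt (d.smul e he) hinj hex ι y = a) ↔
            ∀ Q : (W.baseChange ℚ_[p]).toAffine.Point, ‖a * LocalLog.padicLog (W.baseChange ℚ_[p]) Q‖ ≤ 1) →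
          padicValRat p u = (ι e).valuation) ∧
      Inner d κ) :
    ∃ (d : LocalNeronLineAt W p v)
      (hinj : (bdRPeriodRingData (valuation_place_lt_one p v)).CupLogInjective (logCyclotomic p)
        (localRationalTateRep W p (galRestrictPlace v)))
      (hex : ∀ z : contOneCocycles (localRationalTateRep W p (galRestrictPlace v)).toTopRep,
        (bdRPeriodRingData (valuation_place_lt_one p v)).HasDualExp (logCyclotomic p)
          (localRationalTateRep W p (galRestrictPlace v)) fun σ => z.1 σ),
      (∀ a : ℚ_[p], (∃ y, expStarOmegaPadicAt d hinj hex ι y = a) ↔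
        ∀ Q : (W.baseChange ℚ_[p]).toAffine.Point, ‖a * LocalLog.padicLog (W.baseChange ℚ_[p]) Q‖ ≤ 1) ∧
      ∃ κ : ℝ, κ ≠ 0 ∧ (∃ u : ℚ, (u : ℝ) = κ ∧ padicValRat p u = 0) ∧ Inner d κ := by
  obtain ⟨dK, κ, hκ0, ⟨u, hu, hpos⟩, hin⟩ := h
  have hp1 : 1 < p := (Fact.out : p.Prime).one_lt
  -- Kato's Prop. 1.2.3 binders from the cite facts (w2-c3)
  obtain ⟨hinj, hex⟩ := hinj_hex_of_facts W p v hP hDR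
  -- (S5b): a duality-normalised rescaling `e • d_K`
  obtain ⟨e, he, hdual₀⟩ := hdual_of_facts_of_ringHom W p v hT dK hinj hex ι
  -- POS: `v_p(u) = v(ι e)`
  have hval : padicValRat p u = (ι e).valuation := hpos hinj hex e he hdual₀
  -- the unit / power split `ι e = pⁿ · w`
  have hε0 : ι e ≠ 0 := (map_ne_zero_iff _ ι.injective).mpr he
  have hpQ : ((p : ℕ) : ℚ_[p]) ≠ 0 := by exact_mod_cast (Fact.out : p.Prime).ne_zero
  obtain ⟨n, hn⟩ : ∃ n : ℤ, (ι e).valuation = n := ⟨_, rfl⟩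
  have hnormε : ‖ι e‖ = ((p : ℕ) : ℝ) ^ (-n) := hn ▸ Padic.norm_eq_zpow_neg_valuation hε0
  have hw' : ∃ w : ℚ_[p], w = ι e * ((p : ℕ) : ℚ_[p]) ^ (-n) := ⟨_, rfl⟩
  obtain ⟨w, hwdef⟩ := hw'
  have hw1 : ‖w‖ = 1 := by
    have hpR : (((p : ℕ) : ℝ)) ^ (-n) ≠ 0 :=
      zpow_ne_zero _ (by exact_mod_cast (Fact.out : p.Prime).ne_zero)
    rw [hwdef, norm_mul, norm_zpow, Padic.norm_p, hnormε, inv_zpow, mul_inv_cancel₀ hpR]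
  have hw0 : w ≠ 0 := norm_pos_iff.mp (by rw [hw1]; exact one_pos)
  have hεw : ((p : ℕ) : ℚ_[p]) ^ n * w = ι e := by
    rw [hwdef, mul_left_comm, ← zpow_add₀ hpQ, add_neg_cancel, zpow_zero, mul_one]
  -- the rescaling scalar `c := pⁿ ∈ ℚ_v` and the rational `q := p⁻ⁿ`
  have hpv : ((p : ℕ) : Place.Completion (Sum.inr v : Place ℚ)) ≠ 0 := by
    exact_mod_cast (Fact.out : p.Prime).ne_zero
  have hc' : ∃ c : Place.Completion (Sum.inr v : Place ℚ),
      c = ((p : ℕ) : Place.Completion (Sum.inr v : Place ℚ)) ^ n := ⟨_, rfl⟩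
  obtain ⟨c, hcdef⟩ := hc'
  have hc : c ≠ 0 := by rw [hcdef]; exact zpow_ne_zero _ hpv
  have hιc : ι c = ((p : ℕ) : ℚ_[p]) ^ n := by rw [hcdef, map_zpow₀, map_natCast]
  have hq' : ∃ q : ℚ, q = ((p : ℕ) : ℚ) ^ (-n) := ⟨_, rfl⟩
  obtain ⟨q, hqdef⟩ := hq'
  have hq : (q : ℚ_[p]) = (((p : ℕ) : ℚ_[p]) ^ n)⁻¹ := by
    rw [hqdef, Rat.cast_zpow, Rat.cast_natCast, zpow_neg]
  have hq0 : q ≠ 0 := by rw [hqdef]; exact zpow_ne_zero _ (by exact_mod_cast (Fact.out : p.Prime).ne_zero)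
  have hιcq : ι c = ((q : ℚ_[p]))⁻¹ := by rw [hιc, hq, inv_inv]
  -- the two scale laws, read in `ℚ_p`
  have hAte : ∀ h, expStarOmegaAt (dK.smul e he) h = e⁻¹ * expStarOmegaAt dK h :=
    fun h => expStarOmega_smul _ _ dK he h
  have hAtc : ∀ h, expStarOmegaAt (dK.smul c hc) h = c⁻¹ * expStarOmegaAt dK h :=
    fun h => expStarOmega_smul _ _ dK hc h
  have hφ : ∀ y, expStarOmegaPadicAt (dK.smul c hc) hinj hex ι y =
      w * expStarOmegaPadicAt (dK.smul e he) hinj hex ι y := by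
    intro y
    rw [expStarOmegaPadicAt_apply, expStarOmegaPadicAt_apply, hAtc, hAte, map_mul, map_mul, map_inv₀,
      map_inv₀, hιc, ← hεw, mul_inv, mul_comm ((((p : ℕ) : ℚ_[p]) ^ n)⁻¹) w⁻¹, mul_assoc w⁻¹,
      mul_inv_cancel_left₀ hw0]
  refine ⟨dK.smul c hc, hinj, hex, hdual_transfer_of_norm_eq_one W p v hw1 hφ hdual₀, (q : ℝ) * κ,
    mul_ne_zero (by exact_mod_cast hq0) hκ0, ⟨q * u, by push_cast; rw [hu], ?_⟩,
    hcov dK κ c hc q hq0 hιcq hin⟩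
  -- R-κ: `v_p(p⁻ⁿ · u) = -n + n = 0`
  have hu0 : u ≠ 0 := by
    rintro rfl
    exact hκ0 (by rw [← hu]; push_cast; rfl)
  have hval' : padicValRat p u = n := hval.trans hn
  rw [padicValRat.mul hq0 hu0, hval', hqdef, padicValRat.zpow, padicValRat.of_nat, padicValNat.self hp1]
  push_cast
  ring

/-- **The R-κ-free twin** (w2-c2's rescaling trick in the same abstract form, for the deep family / any consumer
without a unit clause): (P123) ∧ (DR) ∧ (S5b) and «∃ d κ, κ ≠ 0 ∧ Inner d κ» give
«∃ d hinj hex, hdual(d) ∧ ∃ κ, κ ≠ 0 ∧ Inner d κ». [cite: Kato1993LNM1553, Ch. II §1.2.4 and Thm. 1.4.1]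
[cite: BlochKato1990, §3 (Prop. 3.8, Ex. 3.11)] -/
theorem exists_dual_of_inner [W.IsGloballyMinimal]
    (hP : cupLogInjective_and_hasDualExp_of_isDeRham) (hDR : isDeRham_restrictedRationalTateRep)
    (hT : exists_smul_range_expStarCoord_iff_trace_log)
    (ι : Place.Completion (Sum.inr v : Place ℚ) →+* ℚ_[p])
    (Inner : LocalNeronLineAt W p v → ℝ → Prop)
    (hcov : ∀ (d : LocalNeronLineAt W p v) (κ : ℝ) (c : Place.Completion (Sum.inr v : Place ℚ)) (hc : c ≠ 0)
      (q : ℚ), q ≠ 0 → ι c = ((q : ℚ_[p]))⁻¹ → Inner d κ → Inner (d.smul c hc) ((q : ℝ) * κ))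
    (h : ∃ (d : LocalNeronLineAt W p v) (κ : ℝ), κ ≠ 0 ∧ Inner d κ) :
    ∃ (d : LocalNeronLineAt W p v)
      (hinj : (bdRPeriodRingData (valuation_place_lt_one p v)).CupLogInjective (logCyclotomic p)
        (localRationalTateRep W p (galRestrictPlace v)))
      (hex : ∀ z : contOneCocycles (localRationalTateRep W p (galRestrictPlace v)).toTopRep,
        (bdRPeriodRingData (valuation_place_lt_one p v)).HasDualExp (logCyclotomic p)
          (localRationalTateRep W p (galRestrictPlace v)) fun σ => z.1 σ),
      (∀ a : ℚ_[p], (∃ y, expStarOmegaPadicAt d hinj hex ι y = a) ↔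
        ∀ Q : (W.baseChange ℚ_[p]).toAffine.Point, ‖a * LocalLog.padicLog (W.baseChange ℚ_[p]) Q‖ ≤ 1) ∧
      ∃ κ : ℝ, κ ≠ 0 ∧ Inner d κ := by
  obtain ⟨dK, κ, hκ0, hin⟩ := h
  obtain ⟨hinj, hex⟩ := hinj_hex_of_facts W p v hP hDR
  obtain ⟨e, he, hdual₀⟩ := hdual_of_facts_of_ringHom W p v hT dK hinj hex ι
  have hε0 : ι e ≠ 0 := (map_ne_zero_iff _ ι.injective).mpr he
  have hpQ : ((p : ℕ) : ℚ_[p]) ≠ 0 := by exact_mod_cast (Fact.out : p.Prime).ne_zero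
  obtain ⟨n, hn⟩ : ∃ n : ℤ, (ι e).valuation = n := ⟨_, rfl⟩
  have hnormε : ‖ι e‖ = ((p : ℕ) : ℝ) ^ (-n) := hn ▸ Padic.norm_eq_zpow_neg_valuation hε0
  have hw' : ∃ w : ℚ_[p], w = ι e * ((p : ℕ) : ℚ_[p]) ^ (-n) := ⟨_, rfl⟩
  obtain ⟨w, hwdef⟩ := hw'
  have hw1 : ‖w‖ = 1 := by
    have hpR : (((p : ℕ) : ℝ)) ^ (-n) ≠ 0 :=
      zpow_ne_zero _ (by exact_mod_cast (Fact.out : p.Prime).ne_zero)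
    rw [hwdef, norm_mul, norm_zpow, Padic.norm_p, hnormε, inv_zpow, mul_inv_cancel₀ hpR]
  have hw0 : w ≠ 0 := norm_pos_iff.mp (by rw [hw1]; exact one_pos)
  have hεw : ((p : ℕ) : ℚ_[p]) ^ n * w = ι e := by
    rw [hwdef, mul_left_comm, ← zpow_add₀ hpQ, add_neg_cancel, zpow_zero, mul_one]
  have hpv : ((p : ℕ) : Place.Completion (Sum.inr v : Place ℚ)) ≠ 0 := by
    exact_mod_cast (Fact.out : p.Prime).ne_zero
  have hc' : ∃ c : Place.Completion (Sum.inr v : Place ℚ),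
      c = ((p : ℕ) : Place.Completion (Sum.inr v : Place ℚ)) ^ n := ⟨_, rfl⟩
  obtain ⟨c, hcdef⟩ := hc'
  have hc : c ≠ 0 := by rw [hcdef]; exact zpow_ne_zero _ hpv
  have hιc : ι c = ((p : ℕ) : ℚ_[p]) ^ n := by rw [hcdef, map_zpow₀, map_natCast]
  have hq' : ∃ q : ℚ, q = ((p : ℕ) : ℚ) ^ (-n) := ⟨_, rfl⟩
  obtain ⟨q, hqdef⟩ := hq'
  have hq : (q : ℚ_[p]) = (((p : ℕ) : ℚ_[p]) ^ n)⁻¹ := by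
    rw [hqdef, Rat.cast_zpow, Rat.cast_natCast, zpow_neg]
  have hq0 : q ≠ 0 := by rw [hqdef]; exact zpow_ne_zero _ (by exact_mod_cast (Fact.out : p.Prime).ne_zero)
  have hιcq : ι c = ((q : ℚ_[p]))⁻¹ := by rw [hιc, hq, inv_inv]
  have hAte : ∀ h, expStarOmegaAt (dK.smul e he) h = e⁻¹ * expStarOmegaAt dK h :=
    fun h => expStarOmega_smul _ _ dK he h
  have hAtc : ∀ h, expStarOmegaAt (dK.smul c hc) h = c⁻¹ * expStarOmegaAt dK h :=
    fun h => expStarOmega_smul _ _ dK hc h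
  have hφ : ∀ y, expStarOmegaPadicAt (dK.smul c hc) hinj hex ι y =
      w * expStarOmegaPadicAt (dK.smul e he) hinj hex ι y := by
    intro y
    rw [expStarOmegaPadicAt_apply, expStarOmegaPadicAt_apply, hAtc, hAte, map_mul, map_mul, map_inv₀,
      map_inv₀, hιc, ← hεw, mul_inv, mul_comm ((((p : ℕ) : ℚ_[p]) ^ n)⁻¹) w⁻¹, mul_assoc w⁻¹,
      mul_inv_cancel_left₀ hw0]
  exact ⟨dK.smul c hc, hinj, hex, hdual_transfer_of_norm_eq_one W p v hw1 hφ hdual₀, (q : ℝ) * κ,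
    mul_ne_zero (by exact_mod_cast hq0) hκ0, hcov dK κ c hc q hq0 hιcq hin⟩

end Summit.BirchSwinnertonDyer.BirchSwinnertonDyer.Theorems.KimAtThreeFineKatoOuterRescale

end
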